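import Summits.CriticalPhenomena.PercolationContinuityZ3.Theorems.PercNearOneGluingNoHeavyLowerTailSunflowerMultiPetalPendant
import HarnessLib
import HarnessLib.Audit

/-!
# `NoHeavyLowerTail` (crux stmt-CriticalPhenomena-4575), abstract sunflower cubic, `k` petals: a REDUCTION CALCULUS for ★ₖ on sub-cubes —
# the inductive predicate `MSunflower.PencilReducible F W` (sound rules: inert coordinate, non-bottom singleton, pendant coordinate with
# contraction, pencil inequality with contraction) and `PencilReducible F W → 0 ≤ F.ZKW W`

Support file (seat `prim-l12-p2` gen 35; `--supports stmt-CriticalPhenomena-4575`; companion of `…SunflowerMultiPetalPendant` (p377883: pendant identity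
`ZKW_insert_eq_two_mul_add_contract`, `ZKW_insert_eq_three_mul_of_inert`), `…SunflowerMultiPetalSingleton` (p343107: (MZₖ) at a non-bottom singleton) and
`…SunflowerMultiPetalComap` (p368479: `MSunflower.contract`)).  Everything here is PROVED; nothing is asserted about the crux; no `sorry`.
Memo: run/shared/lean/prim/prim-l12/prim-l12-p2/FINDING-g35-GRAPH-PENCIL.md §2–§3.

THE CALCULUS.  Gen-35's pencil identity at a coordinate `e` of a window `W` (`e ∈ W`, `W' = W.erase e`) reads
`ZKW W = 2·ZKW W' + (F.contract {e}).ZKW W' + X_e`; a window is reduced to smaller windows — of `F` AND of the contraction `F.contract {e}` — by any of: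
* INERT `e` (`lab (insert e X) = lab X` on `W'`): `ZKW W = 3·ZKW W'`;
* NON-BOTTOM SINGLETON `{e}` (`lab {e} ≠ 0`): `ZKW W ≥ ZKW W'` (p343107);
* PENDANT `e` acting through some `u` on `W'`: `ZKW W = 2·ZKW W' + (F.contract {e}).ZKW W'` (p377883) — continue with BOTH `F` on `W'` and the contraction on `W'`;
* PENCIL `e`: any externally proved inequality `2·ZKW W' + (F.contract {e}).ZKW W' ≤ ZKW W` (the pencil-vertex inequality `X_e ≥ 0` of the memo, e.g. the closed
  forms for cycles / wheels / fans / windmills / complete (multipartite) graphs of memo §2b–2d) — continue with both.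
`MSunflower.PencilReducible` is the inductive closure of these rules from the empty window; `ZKW_nonneg_of_pencilReducible` is its soundness
(structural induction; the contraction is again an `MSunflower`, so the predicate is indexed by the structure).  This packages the window inductions of
`ZKW_nonneg_of_pendantOrder` (p377883) and of the clutter files in a form that accepts per-family pencil lemmas.
-/

namespace Summit.CriticalPhenomena.PercolationContinuityZ3.Theorems.SunflowerPartition

open Finset

variable {α : Type*} [DecidableEq α] [Fintype α] {k : ℕ}

namespace MSunflower

/-- **Pencil-reducible windows** (this work): the inductive closure, over all structures `F : MSunflower k α` simultaneously, of the four sound reduction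
rules INERT / NON-BOTTOM SINGLETON / PENDANT (acts through `u`, with contraction) / PENCIL (an assumed pencil inequality, with contraction). [this work] -/
inductive PencilReducible : MSunflower k α → Finset α → Prop
  | empty (F : MSunflower k α) : PencilReducible F ∅
  | inert (F : MSunflower k α) (W : Finset α) (e : α) (he : e ∈ W)
      (hinert : ∀ X : Finset α, X ⊆ W.erase e → F.lab (insert e X) = F.lab X)
      (h : PencilReducible F (W.erase e)) : PencilReducible F W
  | single (F : MSunflower k α) (W : Finset α) (e : α) (he : e ∈ W) (hlab : F.lab {e} ≠ 0)
      (h : PencilReducible F (W.erase e)) : PencilReducible F W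
  | pendant (F : MSunflower k α) (W : Finset α) (e u : α) (he : e ∈ W)
      (hact : ∀ X : Finset α, X ⊆ W.erase e → u ∉ X → F.lab (insert e X) = F.lab X)
      (h₁ : PencilReducible F (W.erase e)) (h₂ : PencilReducible (F.contract {e}) (W.erase e)) : PencilReducible F W
  | pencil (F : MSunflower k α) (W : Finset α) (e : α) (he : e ∈ W)
      (hX : 2 * F.ZKW (W.erase e) + (F.contract {e}).ZKW (W.erase e) ≤ F.ZKW W)
      (h₁ : PencilReducible F (W.erase e)) (h₂ : PencilReducible (F.contract {e}) (W.erase e)) : PencilReducible F W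

/-- **Soundness of the reduction calculus** (this work): every pencil-reducible window has a nonnegative partition functional, `0 ≤ ZKW W`. [this work] -/
theorem ZKW_nonneg_of_pencilReducible {F : MSunflower k α} {W : Finset α} (h : PencilReducible F W) : 0 ≤ F.ZKW W := by
  induction h with
  | empty F => rw [F.ZKW_empty]
  | inert F W e he hinert _ ih =>
    have hWe : insert e (W.erase e) = W := insert_erase he
    have h3 := F.ZKW_insert_eq_three_mul_of_inert (W.erase e) e (notMem_erase e W) hinert
    rw [hWe] at h3
    rw [h3]
    linarith
  | single F W e he hlab _ ih =>
    have hWe : insert e (W.erase e) = W := insert_erase he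
    have hmz := F.ZKW_le_ZKW_insert_of_lab_singleton_ne_zero (W.erase e) e (notMem_erase e W) hlab
    rw [hWe] at hmz
    linarith
  | pendant F W e u he hact _ _ ih₁ ih₂ =>
    have hWe : insert e (W.erase e) = W := insert_erase he
    have hid := F.ZKW_insert_eq_two_mul_add_contract (W.erase e) e u (notMem_erase e W) hact
    rw [hWe] at hid
    rw [hid]
    linarith
  | pencil F W e he hX _ _ ih₁ ih₂ => linarith

/-- Whole-cube form: if the full window is pencil-reducible then ★ₖ holds for `F`. [this work] -/
theorem ZK_nonneg_of_pencilReducible {F : MSunflower k α} (h : PencilReducible F univ) : 0 ≤ F.ZK := by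
  rw [← F.ZKW_univ]
  exact ZKW_nonneg_of_pencilReducible h

omit [Fintype α] in
/-- Structures whose labels agree on a window have the same functional there. [this work] -/
theorem ZKW_congr_of_lab_eq (G F : MSunflower k α) (W : Finset α) (h : ∀ X : Finset α, X ⊆ W → G.lab X = F.lab X) :
    G.ZKW W = F.ZKW W := by
  unfold ZKW
  exact nested_congr_of_subset W _ _ fun X S T hX hS hT => by rw [h X hX, h S hS, h T hT]

/-- **Transport**: pencil-reducibility of a window depends only on the labels of its subsets. [this work] -/
theorem PencilReducible.of_lab_eq (G F : MSunflower k α) (W : Finset α) (hGF : ∀ X : Finset α, X ⊆ W → G.lab X = F.lab X)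
    (h : PencilReducible F W) : PencilReducible G W := by
  induction h generalizing G with
  | empty F => exact PencilReducible.empty G
  | inert F W e he hinert _ ih =>
    have hW : W.erase e ⊆ W := erase_subset e W
    refine PencilReducible.inert G W e he (fun X hX => ?_) (ih G fun X hX => hGF X (hX.trans hW))
    rw [hGF _ (insert_subset he (hX.trans hW)), hGF X (hX.trans hW)]
    exact hinert X hX
  | single F W e he hlab _ ih =>
    have hW : W.erase e ⊆ W := erase_subset e W
    refine PencilReducible.single G W e he ?_ (ih G fun X hX => hGF X (hX.trans hW))
    rw [hGF {e} (singleton_subset_iff.2 he)]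
    exact hlab
  | pendant F W e u he hact _ _ ih₁ ih₂ =>
    have hW : W.erase e ⊆ W := erase_subset e W
    have hc : ∀ X : Finset α, X ⊆ W.erase e → (G.contract {e}).lab X = (F.contract {e}).lab X := by
      intro X hX
      rw [lab_contract, lab_contract, ← insert_eq]
      exact hGF _ (insert_subset he (hX.trans hW))
    refine PencilReducible.pendant G W e u he (fun X hX huX => ?_) (ih₁ G fun X hX => hGF X (hX.trans hW)) (ih₂ (G.contract {e}) hc)
    rw [hGF _ (insert_subset he (hX.trans hW)), hGF X (hX.trans hW)]
    exact hact X hX huX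
  | pencil F W e he hX _ _ ih₁ ih₂ =>
    have hW : W.erase e ⊆ W := erase_subset e W
    have hc : ∀ X : Finset α, X ⊆ W.erase e → (G.contract {e}).lab X = (F.contract {e}).lab X := by
      intro X hX
      rw [lab_contract, lab_contract, ← insert_eq]
      exact hGF _ (insert_subset he (hX.trans hW))
    refine PencilReducible.pencil G W e he ?_ (ih₁ G fun X hX => hGF X (hX.trans hW)) (ih₂ (G.contract {e}) hc)
    rw [ZKW_congr_of_lab_eq G F W hGF, ZKW_congr_of_lab_eq G F (W.erase e) (fun X hX => hGF X (hX.trans hW)),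
      ZKW_congr_of_lab_eq (G.contract {e}) (F.contract {e}) (W.erase e) hc]
    exact hX

/-- The PENDANT rule with the non-bottom pair folded in (this work): if `e` acts through `u ∈ W.erase e` with `lab (insert e {u}) ≠ 0`, it suffices to reduce
`W.erase e` and `(W.erase e).erase u` for `F` itself (the contraction is discharged by p343107 at the non-bottom singleton `{u}`). [this work] -/
theorem PencilReducible.pendant_pair (F : MSunflower k α) (W : Finset α) (e u : α) (he : e ∈ W) (hu : u ∈ W.erase e)
    (hact : ∀ X : Finset α, X ⊆ W.erase e → u ∉ X → F.lab (insert e X) = F.lab X) (hne : F.lab (insert e {u}) ≠ 0)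
    (h₁ : PencilReducible F (W.erase e)) (h₂ : PencilReducible F ((W.erase e).erase u)) : PencilReducible F W := by
  refine PencilReducible.pencil F W e he ?_ h₁ ?_
  · -- the pendant identity gives equality
    have hid := F.ZKW_insert_eq_two_mul_add_contract (W.erase e) e u (notMem_erase e W) hact
    rw [insert_erase he] at hid
    rw [hid]
  · -- the contraction: delete the non-bottom singleton `u`, then it agrees with `F` on `(W.erase e).erase u`
    have hlab : (F.contract {e}).lab {u} ≠ 0 := by
      rw [lab_contract, ← insert_eq]
      exact hne
    refine PencilReducible.single (F.contract {e}) (W.erase e) u hu hlab ?_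
    -- on `(W.erase e).erase u` the contraction is pencil-reducible because `F` is: transport along equality of labels
    have hagree : ∀ X : Finset α, X ⊆ (W.erase e).erase u → (F.contract {e}).lab X = F.lab X := by
      intro X hX
      rw [lab_contract, ← insert_eq]
      exact hact X (hX.trans (erase_subset u (W.erase e))) (fun h => notMem_erase u (W.erase e) (hX h))
    exact PencilReducible.of_lab_eq (F.contract {e}) F ((W.erase e).erase u) hagree h₂

end MSunflower

end Summit.CriticalPhenomena.PercolationContinuityZ3.Theorems.SunflowerPartition
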